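import Summits.Ventures.HodgeRepro2.T5SU11SphericalContinuous

/-!
# The asymptotics of the spherical functions of `SU(1,1)`: `e^{λt} φ_λ(a_t) → c(λ)` (Harish-Chandra's
`c`-function) as `t → ∞` for `λ < 1`

Laplace's integral `sph λ (a_t) = (2π)⁻¹ ∫_{-π}^{π} (cosh 2t - sinh 2t cos φ)^{-λ/2} dφ`
(`T5SU11SphericalBounds.sph_hyp_eq_laplace`) rescales as
`e^{λt} sph λ (a_t) = (2π)⁻¹ ∫_{-π}^{π} ((1 - cos φ)/2 + e^{-4t} (1 + cos φ)/2)^{-λ/2} dφ`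
(`exp_mul_sph_hyp_eq`; `e^{-2t}(cosh 2t - sinh 2t cos φ) = (1 - cos φ)/2 + e^{-4t}(1 + cos φ)/2`,
`exp_neg_two_mul_laplace_base`). As `t → ∞` the integrand decreases to `((1 - cos φ)/2)^{-λ/2}`
(`= |sin(φ/2)|^{-λ}`), which is integrable on `(-π, π)` exactly when `λ < 1` — the comparison
`sin²(φ/2) ≥ (φ/π)²` on `[-π, π]` (Jordan's inequality, `sin_half_sq_ge`) against `|φ|^{-λ}`
(`intervalIntegrable_cLimit`) — so by dominated convergence (`cLimit_add_one` is a bound for `t ≥ 0`,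
`rescaled_le_bound`)
**`e^{λt} sph λ (a_t) → c(λ) := (2π)⁻¹ ∫_{-π}^{π} ((1 - cos φ)/2)^{-λ/2} dφ`** (`tendsto_exp_mul_sph_hyp`),
Harish-Chandra's `c`-function of the explicit model (`cfun`; `cfun 0 = 1`). By the functional
equation `sph λ = sph (2 - λ)` (`T5SU11SphericalSymmetry.sph_two_sub`) the other side reads
**`e^{(2-λ)t} sph λ (a_t) → c(2 - λ)` for `λ > 1`** (`tendsto_exp_two_sub_mul_sph_hyp`) — the classical
`φ_λ(a_t) ~ c(λ) e^{(λ - 2ρ) t}`, `2ρ = 2`. Nothing is claimed about (N).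

Blind lane: Mathlib + the HodgeRepro2 prefix only; no sorry; axioms ⊆ {propext, Classical.choice,
Quot.sound}.
-/

namespace Summit.Ventures.HodgeRepro2.T5SU11SphericalAsymptotic

open MeasureTheory Metric Set Filter Topology Complex intervalIntegral
open T5SU11Unimodular T5SU11Fibration T5SU11Cartan T5SU11OneParameter T5SU11CartanProjection
  T5HaarCircle T5SU11SphericalFunction T5SU11SphericalTwo T5SU11SphericalSymmetry
  T5SU11SphericalBounds T5SU11SphericalContinuous
open scoped Real

/-! ### The rescaled Laplace integrand -/

/-- `e^{-2t} (cosh 2t - sinh 2t cos φ) = (1 - cos φ)/2 + e^{-4t} (1 + cos φ)/2`. -/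
lemma exp_neg_two_mul_laplace_base (t φ : ℝ) :
    Real.exp (-(2 * t)) * (Real.cosh (2 * t) - Real.sinh (2 * t) * Real.cos φ) =
      (1 - Real.cos φ) / 2 + Real.exp (-(4 * t)) * ((1 + Real.cos φ) / 2) := by
  have h4 : Real.exp (-(4 * t)) = Real.exp (-(2 * t)) * Real.exp (-(2 * t)) := by
    rw [← Real.exp_add]
    congr 1
    ring
  have h1 : Real.exp (-(2 * t)) * Real.exp (2 * t) = 1 := by
    rw [← Real.exp_add]
    simp
  rw [Real.cosh_eq, Real.sinh_eq, h4]
  linear_combination ((1 - Real.cos φ) / 2) * h1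

/-- The rescaled base `(1 - cos φ)/2 + e^{-4t} (1 + cos φ)/2` is positive. -/
lemma rescaled_base_pos (t φ : ℝ) :
    0 < (1 - Real.cos φ) / 2 + Real.exp (-(4 * t)) * ((1 + Real.cos φ) / 2) := by
  rw [← exp_neg_two_mul_laplace_base]
  exact mul_pos (Real.exp_pos _) (laplace_base_pos t φ)

/-- **The rescaled Laplace integral**:
`e^{λt} sph λ (a_t) = (2π)⁻¹ ∫_{-π}^{π} ((1 - cos φ)/2 + e^{-4t} (1 + cos φ)/2)^{-λ/2} dφ`. -/
theorem exp_mul_sph_hyp_eq [MeasurableSpace Circle] [BorelSpace Circle] (lam t : ℝ) :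
    Real.exp (lam * t) * sph lam (hyp t) =
      (2 * π)⁻¹ * ∫ φ in (-π)..π,
        ((1 - Real.cos φ) / 2 + Real.exp (-(4 * t)) * ((1 + Real.cos φ) / 2)) ^ (-lam / 2) := by
  rw [sph_hyp_eq_laplace, mul_left_comm, ← intervalIntegral.integral_const_mul]
  congr 2
  funext φ
  rw [← exp_neg_two_mul_laplace_base,
    Real.mul_rpow (Real.exp_pos _).le (laplace_base_pos t φ).le,
    ← Real.exp_mul]
  congr 2
  ring

/-! ### The limit integrand and its integrability -/

/-- The limit integrand `cLimit λ φ = ((1 - cos φ)/2)^{-λ/2}` (`= |sin(φ/2)|^{-λ}`). -/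
noncomputable def cLimit (lam φ : ℝ) : ℝ := ((1 - Real.cos φ) / 2) ^ (-lam / 2)

/-- **Harish-Chandra's `c`-function of the explicit model**:
`cfun λ = (2π)⁻¹ ∫_{-π}^{π} ((1 - cos φ)/2)^{-λ/2} dφ` (the integral converges for `λ < 1`). -/
noncomputable def cfun (lam : ℝ) : ℝ := (2 * π)⁻¹ * ∫ φ in (-π)..π, cLimit lam φ

/-- `cfun 0 = 1`. -/
lemma cfun_zero : cfun 0 = 1 := by
  unfold cfun cLimit
  simp only [neg_zero, zero_div, Real.rpow_zero]
  rw [intervalIntegral.integral_const, smul_eq_mul, mul_one, show π - -π = 2 * π by ring,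
    inv_mul_cancel₀ (by positivity)]

/-- `cLimit λ φ ≥ 0`. -/
lemma cLimit_nonneg (lam φ : ℝ) : 0 ≤ cLimit lam φ :=
  Real.rpow_nonneg (by linarith [Real.cos_le_one φ]) _

/-- `(1 - cos φ)/2 = sin (φ/2) ^ 2`. -/
lemma one_sub_cos_div_two (φ : ℝ) : (1 - Real.cos φ) / 2 = Real.sin (φ / 2) ^ 2 := by
  have h : Real.cos φ = 2 * Real.cos (φ / 2) ^ 2 - 1 := by
    rw [← Real.cos_two_mul]
    congr 1
    ring
  rw [h, Real.cos_sq']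
  ring

/-- **Jordan's inequality, squared**: `(φ/π)² ≤ sin (φ/2) ^ 2` for `-π ≤ φ ≤ π`. -/
lemma sin_half_sq_ge {φ : ℝ} (h1 : -π ≤ φ) (h2 : φ ≤ π) : (φ / π) ^ 2 ≤ Real.sin (φ / 2) ^ 2 := by
  have hπ := Real.pi_pos
  have key : |φ / π| ≤ |Real.sin (φ / 2)| := by
    rcases le_or_gt 0 φ with hφ | hφ
    · have hs := Real.mul_le_sin (x := φ / 2) (by linarith) (by linarith)
      have h0 : 0 ≤ 2 / π * (φ / 2) := by positivity
      rw [abs_of_nonneg (div_nonneg hφ hπ.le), abs_of_nonneg (by linarith)]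
      calc φ / π = 2 / π * (φ / 2) := by field_simp
        _ ≤ Real.sin (φ / 2) := hs
    · have hs := Real.mul_le_sin (x := -φ / 2) (by linarith) (by linarith)
      have h0 : 0 ≤ 2 / π * (-φ / 2) := mul_nonneg (by positivity) (by linarith)
      have hsin : Real.sin (φ / 2) = -Real.sin (-φ / 2) := by
        rw [neg_div, Real.sin_neg, neg_neg]
      rw [hsin, abs_neg, abs_of_neg (div_neg_of_neg_of_pos hφ hπ), abs_of_nonneg (by linarith)]
      calc -(φ / π) = 2 / π * (-φ / 2) := by field_simp
        _ ≤ Real.sin (-φ / 2) := hs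
  have := pow_le_pow_left₀ (abs_nonneg _) key 2
  rwa [sq_abs, sq_abs] at this

/-- `|x|^r` is interval integrable on `[-c, c]` for `-1 < r`. -/
lemma intervalIntegrable_abs_rpow {r : ℝ} (hr : -1 < r) {c : ℝ} (hc : 0 ≤ c) :
    IntervalIntegrable (fun x : ℝ => |x| ^ r) volume (-c) c := by
  have h1 : IntervalIntegrable (fun x : ℝ => |x| ^ r) volume 0 c := by
    refine (intervalIntegrable_rpow' hr (a := 0) (b := c)).congr_uIoo fun x hx => ?_
    rw [uIoo_of_le hc] at hx
    simp only [abs_of_pos hx.1]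
  have h2 : IntervalIntegrable (fun x : ℝ => |x| ^ r) volume (-c) 0 := by
    rw [IntervalIntegrable.iff_comp_neg]
    simp only [abs_neg, neg_neg, neg_zero]
    exact h1.symm
  exact h2.trans h1

/-- **The limit integrand is integrable on `(-π, π)` for `λ < 1`**: `cLimit λ ≤ π^λ |φ|^{-λ}`
(Jordan) and `|φ|^{-λ}` is integrable iff `λ < 1`. -/
theorem intervalIntegrable_cLimit {lam : ℝ} (hlam : lam < 1) :
    IntervalIntegrable (cLimit lam) volume (-π) π := by
  have hπ := Real.pi_pos
  rcases le_or_gt lam 0 with h0 | h0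
  · -- `λ ≤ 0`: the integrand is continuous
    have hc : Continuous (cLimit lam) := by
      unfold cLimit
      exact (Real.continuous_rpow_const (by linarith)).comp (by fun_prop)
    exact hc.intervalIntegrable _ _
  · -- `0 < λ < 1`: compare with `π^λ |φ|^{-λ}`
    have hg : IntervalIntegrable (fun φ : ℝ => π ^ lam * |φ| ^ (-lam)) volume (-π) π :=
      (intervalIntegrable_abs_rpow (by linarith) hπ.le).const_mul _
    refine hg.mono_fun' ?_ ?_
    · exact (Measurable.pow_const (by fun_prop) _).aestronglyMeasurable
    · rw [Filter.EventuallyLE, ae_restrict_iff' measurableSet_uIoc]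
      refine Filter.Eventually.of_forall fun φ hφ => ?_
      rw [uIoc_of_le (by linarith), mem_Ioc] at hφ
      rw [Real.norm_eq_abs, abs_of_nonneg (cLimit_nonneg _ _)]
      rcases eq_or_ne φ 0 with rfl | hφ0
      · -- at `φ = 0` the left side is `0^{-λ/2} = 0`
        unfold cLimit
        rw [Real.cos_zero, sub_self, zero_div, Real.zero_rpow (by intro h; linarith [neg_div 2 lam])]
        positivity
      · unfold cLimit
        rw [one_sub_cos_div_two]
        have hsq : 0 < (φ / π) ^ 2 := by positivity
        calc (Real.sin (φ / 2) ^ 2) ^ (-lam / 2)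
            ≤ ((φ / π) ^ 2) ^ (-lam / 2) :=
              Real.rpow_le_rpow_of_nonpos hsq (sin_half_sq_ge hφ.1.le hφ.2) (by linarith)
          _ = π ^ lam * |φ| ^ (-lam) := by
              rw [← sq_abs, ← Real.rpow_natCast, ← Real.rpow_mul (abs_nonneg _), abs_div,
                abs_of_pos hπ, Real.div_rpow (abs_nonneg _) hπ.le, div_eq_mul_inv,
                ← Real.rpow_neg hπ.le, mul_comm]
              congr 2
              · push_cast
                ring
              · ring

/-! ### The domination and the limit -/

/-- **The domination for `t ≥ 0`**: `((1 - cos φ)/2 + e^{-4t}(1 + cos φ)/2)^{-λ/2} ≤ cLimit λ φ + 1`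
for `φ ∈ (-π, π]`, `φ ≠ 0`. -/
lemma rescaled_le_bound {lam t φ : ℝ} (ht : 0 ≤ t) (h1 : -π < φ) (h2 : φ ≤ π) (hφ : φ ≠ 0) :
    ((1 - Real.cos φ) / 2 + Real.exp (-(4 * t)) * ((1 + Real.cos φ) / 2)) ^ (-lam / 2) ≤
      cLimit lam φ + 1 := by
  have hcos : Real.cos φ < 1 := by
    rcases (Real.cos_le_one φ).lt_or_eq with h | h
    · exact h
    · exfalso
      exact hφ ((Real.cos_eq_one_iff_of_lt_of_lt (by linarith) (by linarith)).mp h)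
  have hpos : 0 < (1 - Real.cos φ) / 2 := by linarith
  have hexp1 : Real.exp (-(4 * t)) ≤ 1 := by
    rw [Real.exp_le_one_iff]
    linarith
  have hexp0 : 0 ≤ Real.exp (-(4 * t)) := (Real.exp_pos _).le
  have hcos1 : 0 ≤ (1 + Real.cos φ) / 2 := by linarith [Real.neg_one_le_cos φ]
  rcases le_or_gt 0 lam with hl | hl
  · -- `λ ≥ 0`: the exponent is `≤ 0`, the base is `≥ (1 - cos φ)/2`
    have := Real.rpow_le_rpow_of_nonpos hpos
      (show (1 - Real.cos φ) / 2 ≤ (1 - Real.cos φ) / 2 + Real.exp (-(4 * t)) * ((1 + Real.cos φ) / 2)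
        by nlinarith) (show -lam / 2 ≤ 0 by linarith)
    unfold cLimit
    linarith
  · -- `λ < 0`: the exponent is `> 0`, the base is in `[0, 1]`
    have hle1 : (1 - Real.cos φ) / 2 + Real.exp (-(4 * t)) * ((1 + Real.cos φ) / 2) ≤ 1 := by
      nlinarith
    have := Real.rpow_le_one (rescaled_base_pos t φ).le hle1 (show 0 ≤ -lam / 2 by linarith)
    linarith [cLimit_nonneg lam φ]

/-- **The pointwise limit**: `((1 - cos φ)/2 + e^{-4t}(1 + cos φ)/2)^{-λ/2} → cLimit λ φ` as `t → ∞`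
for `φ ≠ 0` in `(-π, π]`. -/
lemma tendsto_rescaled {lam φ : ℝ} (h1 : -π < φ) (h2 : φ ≤ π) (hφ : φ ≠ 0) :
    Tendsto (fun t : ℝ =>
      ((1 - Real.cos φ) / 2 + Real.exp (-(4 * t)) * ((1 + Real.cos φ) / 2)) ^ (-lam / 2))
      atTop (𝓝 (cLimit lam φ)) := by
  have hcos : Real.cos φ < 1 := by
    rcases (Real.cos_le_one φ).lt_or_eq with h | h
    · exact h
    · exfalso
      exact hφ ((Real.cos_eq_one_iff_of_lt_of_lt (by linarith) (by linarith)).mp h)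
  have hpos : 0 < (1 - Real.cos φ) / 2 := by linarith
  have h4 : Tendsto (fun t : ℝ => Real.exp (-(4 * t))) atTop (𝓝 0) := by
    have := Real.tendsto_exp_atBot.comp
      (tendsto_neg_atTop_atBot.comp (tendsto_id.const_mul_atTop (by norm_num : (0 : ℝ) < 4)))
    simpa only [Function.comp_def, id_eq] using this
  have hbase : Tendsto (fun t : ℝ =>
      (1 - Real.cos φ) / 2 + Real.exp (-(4 * t)) * ((1 + Real.cos φ) / 2)) atTop
      (𝓝 ((1 - Real.cos φ) / 2)) := by
    have := (h4.mul_const ((1 + Real.cos φ) / 2)).const_add ((1 - Real.cos φ) / 2)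
    simpa only [zero_mul, add_zero] using this
  exact hbase.rpow_const (Or.inl hpos.ne')

section measure

variable [MeasurableSpace Circle] [BorelSpace Circle]

/-- **Harish-Chandra's asymptotics**: for `λ < 1`, `e^{λt} sph λ (a_t) → c(λ)` as `t → ∞`. -/
theorem tendsto_exp_mul_sph_hyp {lam : ℝ} (hlam : lam < 1) :
    Tendsto (fun t : ℝ => Real.exp (lam * t) * sph lam (hyp t)) atTop (𝓝 (cfun lam)) := by
  have hπ := Real.pi_pos
  have hDCT : Tendsto (fun t : ℝ => ∫ φ in (-π)..π,
      ((1 - Real.cos φ) / 2 + Real.exp (-(4 * t)) * ((1 + Real.cos φ) / 2)) ^ (-lam / 2))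
      atTop (𝓝 (∫ φ in (-π)..π, cLimit lam φ)) := by
    have h0 : ∀ᵐ φ ∂(volume : Measure ℝ), φ ≠ 0 := by
      rw [ae_iff]
      simp only [not_not, Set.setOf_eq_eq_singleton]
      exact Real.volume_singleton
    refine tendsto_integral_filter_of_dominated_convergence (fun φ => cLimit lam φ + 1) ?_ ?_ ?_ ?_
    · refine Filter.Eventually.of_forall fun t => ?_
      refine Continuous.aestronglyMeasurable ?_
      exact Continuous.rpow_const (by fun_prop) fun φ => Or.inl (rescaled_base_pos t φ).ne'
    · filter_upwards [Filter.eventually_ge_atTop 0] with t ht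
      filter_upwards [h0] with φ hφ hmem
      rw [uIoc_of_le (by linarith), mem_Ioc] at hmem
      rw [Real.norm_eq_abs, abs_of_nonneg (Real.rpow_nonneg (rescaled_base_pos t φ).le _)]
      exact rescaled_le_bound ht hmem.1 hmem.2 hφ
    · exact (intervalIntegrable_cLimit hlam).add intervalIntegrable_const
    · filter_upwards [h0] with φ hφ hmem
      rw [uIoc_of_le (by linarith), mem_Ioc] at hmem
      exact tendsto_rescaled hmem.1 hmem.2 hφ
  have e : (fun t : ℝ => Real.exp (lam * t) * sph lam (hyp t)) = fun t : ℝ =>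
      (2 * π)⁻¹ * ∫ φ in (-π)..π,
        ((1 - Real.cos φ) / 2 + Real.exp (-(4 * t)) * ((1 + Real.cos φ) / 2)) ^ (-lam / 2) := by
    funext t
    exact exp_mul_sph_hyp_eq lam t
  rw [e]
  exact hDCT.const_mul _

/-- **The other side of the functional equation**: for `λ > 1`,
`e^{(2 - λ) t} sph λ (a_t) → c(2 - λ)` as `t → ∞` — the classical `φ_λ(a_t) ~ c(λ) e^{(λ - 2) t}`. -/
theorem tendsto_exp_two_sub_mul_sph_hyp {lam : ℝ} (hlam : 1 < lam) :
    Tendsto (fun t : ℝ => Real.exp ((2 - lam) * t) * sph lam (hyp t)) atTop (𝓝 (cfun (2 - lam))) := by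
  have := tendsto_exp_mul_sph_hyp (lam := 2 - lam) (by linarith)
  simpa only [← sph_two_sub] using this

/-- `e^{0} sph 0 (a_t) → cfun 0 = 1`: the asymptotics are consistent with `sph 0 ≡ 1`. -/
theorem tendsto_sph_zero_hyp : Tendsto (fun t : ℝ => sph 0 (hyp t)) atTop (𝓝 1) := by
  have := tendsto_exp_mul_sph_hyp (lam := 0) (by norm_num)
  simpa only [zero_mul, Real.exp_zero, one_mul, cfun_zero] using this

end measure

end Summit.Ventures.HodgeRepro2.T5SU11SphericalAsymptotic
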